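import Mathlib.Analysis.InnerProductSpace.Dual
import Literature.MathematicalPhysics.QuantumFieldTheory.Balaban1983to89.B11Eq90V0primeCurrent

/-!
# `Balaban1983to89.B11Eq98V0primeCurrentSlots` — T. Bałaban, *The variational problem and background fields in renormalization group method for lattice gauge theories*, Commun. Math. Phys. **102** (1985) 277–309 [Balaban1985Variational]: (98) p. 293, (63) p. 287 with (27) p. 282, for the V′₀-group of (90) — THE SLOT STRUCTURES `B11Prop6Scheme.Prop4Hyp` / `B13Contraction113.QuadAnalytic` OF THE SECT. E SCHEME INHABITED BY THE CURRENT `B11Eq90V0primeCurrent.curV0prime` at the (115) carrier, THE PAIRING CERTIFICATE `⟨cur(Y), δ⟩ = (d/dt) Σ_p η^d V′₀(Y + tδ, ∂p)|_{t=0}`, and the dualising map `ρ` of the bilinear trace pairing CONSTRUCTED from the cell's Hilbert-fibre convention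

statement-level skeleton of published theorems with citation tags; proofs where landed; nothing here is a claim about the Yang–Mills mass gap

PDF held: `paper:balaban1985-cmp102-variational-background` (journal page = PDF page + 276); pp. 282, 287, 291 read by this seat from the
`lit read` text layer; displays as transcribed in `B11Eq27Current` ((27)), `B11Eq63FunctionalDerivative` ((63)), `B11Eq85FirstDerivative` ((90)).

CITATION HEADER (lean-in-tree rule 2026-08-18).  WHAT IS REPRODUCED: (63) p. 287 *«The functional derivative is a kernel of the linear operator
acting on functions δA′ and defined as ⟨(δ/δA′)D(A′), δA′⟩ = (d/dτ)D(A′ + τδA′)|_{τ=0}.»* with the pairing (27) p. 282 *«… = ⟨A, J⟩»*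
(`B9Eq39Adjoint.bondPair`: `⟨A, J⟩ = η^d Σ_x Σ_μ tr A_μ(x)J_μ(x)`), APPLIED to the V′₀-group of (90) p. 291: the companion
`B11Eq90V0primeCurrent` DEFINES the current `cur(Y)(b) = Σ_{p∈st(b)} ρ(((∂/∂A(b))V′₀)(Y, ∂p))` on the (115) carriers and PROVES its size bound
and analyticity; THIS file certifies that it IS the functional derivative in print's sense (§6), and constructs the representation datum `ρ`
(§7) from the fibre convention of `B9Eq310HessianOperator` (M2) / [B7] (18): `⟪φ⁻¹X, φ⁻¹Y⟫ = τ(X*Y)`.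

WHAT IS DEFINED AND PROVED (sorry-free; axioms `propext` / `Classical.choice` / `Quot.sound`; one plumbing def `rieszτ`, no `Prop`-valued
definition, no new named fact).
§5b **`prop4Hyp_curV0prime`**, **`quadAnalytic_curV0prime`** — under the displayed hypotheses of `B11Eq90V0primeCurrent.norm_curV0prime_le`,
   `Prop4Hyp (curV0prime ρ τ U₀) C (1/16)` and `QuadAnalytic (curV0prime ρ τ U₀) C (1/16)` with `C = 1024(d − 1)Λ³‖ρ‖(K + 1/16)`: the
   `Regime.quad`-type slot of `B11Eq174Chart` / `B11Prop6Model.SchemeDatum.prop4` AT THE CARRIER, for the V′₀-summand of (L3) `W`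
   (p. 292 «analytic … and satisfies the estimate», (98)).
§6 `curL_eq_sum_bondDelta` (a direction is the sum of its one-bond pieces), **`bondPair_curV0prime`** — for every configuration `Y` of (115)
   and every direction `δ`: `bondPair η d τ (cur(Y)) δ = (d/dt) Σ_{p} η^d V′₀(Y + tδ, ∂p)|_{t=0}`, given the dualising identity
   `τ(ρ(ℓ)X) = ℓ X` — by (63) termwise (`B11Eq90V0Derivative.deriv_line_eq_fderiv`), linearity of the Fréchet derivative, and (90)'s
   «Σ_{p∈st(b)}» (`B11Eq90V0primeBond.dV0primeBond_eq_zero_of_not_mem_st`).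
§7 **`rieszτ φ : (𝔸 →L[ℂ] ℂ) →L[ℂ] 𝔸`** — `ρ(ℓ) = (φ v_ℓ)*`, `v_ℓ` the Riesz vector of `ℓ ∘ φ` in the Hilbert fibre `W` (`φ : W ≃ₗ[ℂ] 𝔸`);
   `ℂ`-LINEAR (the conjugate-linearities of the Riesz map and of `*` cancel — the Riesz vector itself would make the current anti-holomorphic);
   `rieszτ_apply`, **`trace_rieszτ_mul`**: under `⟪φ⁻¹X, φ⁻¹Y⟫ = τ(X*Y)`, `τ(ρ(ℓ)·X) = ℓ(X)` — the hypothesis `hρ` of §6 DISCHARGED for the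
   cell's letters (for `𝔤ᶜ ⊆ M_N(ℂ)`, `τ = tr`: `ρ(ℓ) = Σ_{ij} ℓ(E_{ij})E_{ji}`).

HONEST SCOPE — what is NOT claimed.  (i) As in the companion: the V′₀-current AT `A` (first sum of (90)); no composition with (47), no `𝔇*H*`
term, no other group of (85)–(96).  (ii) The fibre convention is the cell's display (M2) of `B9Eq310HessianOperator`, taken as a hypothesis
`hφτ`; nothing about `M_N(ℂ)` specifically is proved.  (iii) NOT summit progress (cell pub-balaban: NE9 NOT PRINTED / NOT PROVED; spine
PROVED 0/9).  Unit `b2b-balaban-t4-ne9-formalise-leaf-05` (NE9 crux-team leaf prover, gen 64).  Imports `B11Eq90V0primeCurrent` (this lineage)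
and `Mathlib.Analysis.InnerProductSpace.Dual` ONLY.
-/

noncomputable section

open NormedSpace Complex Metric Set Finset Filter Topology
open scoped InnerProductSpace

namespace Literature.MathematicalPhysics.QuantumFieldTheory.Balaban1983to89.B11Eq98V0primeCurrentSlots

open Literature.MathematicalPhysics.QuantumFieldTheory.Balaban1983to89.Beta.TransportVertices
open Literature.MathematicalPhysics.QuantumFieldTheory.Balaban1983to89.Beta.AdjointTransportJets
open Literature.MathematicalPhysics.QuantumFieldTheory.Balaban1983to89.B9Eq37Insertion
open Literature.MathematicalPhysics.QuantumFieldTheory.Balaban1983to89.B9Eq39Adjoint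
open Literature.MathematicalPhysics.QuantumFieldTheory.Balaban1983to89.B11Eq26ActionExpansion
open Literature.MathematicalPhysics.QuantumFieldTheory.Balaban1983to89.B11Eq90V0Derivative
open Literature.MathematicalPhysics.QuantumFieldTheory.Balaban1983to89.B11Eq90StB
open Literature.MathematicalPhysics.QuantumFieldTheory.Balaban1983to89.B11Eq90V0primeBond
open Literature.MathematicalPhysics.QuantumFieldTheory.Balaban1983to89.B11Eq90V0primeCurrent
open B9SectCLatticeCarrier (Bond)
open B4Sect5Torus (TSite)
open B11Eq115Space

variable {𝔸 : Type*} [NormedRing 𝔸] [NormedAlgebra ℂ 𝔸] [CompleteSpace 𝔸]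

/-! ## §5b The `Prop4Hyp` / `QuadAnalytic` slots of the Sect. E scheme, inhabited by the V′₀-current -/

section Slots

variable {d : ℕ} {Pd : Fin d → ℕ} {L η : ℝ} [Fact (0 < L)] [Fact (0 < η)] {lev₀ : Bond d Pd → ℕ} {κ' : Type*} [Fintype κ']
  {lev₁ : κ' → ℕ} {Dc : (Bond d Pd → 𝔸) →ₗ[ℂ] (κ' → 𝔸)} [NormOneClass 𝔸] [StarRing 𝔸] [StarModule ℂ 𝔸]

/-- **PROPOSITION 4's TWO CLAUSES FOR THE V′₀-CURRENT, IN THE FRÉCHET FORM OF THE SECT. E SCHEME** (`B11Prop6Scheme.Prop4Hyp`, the field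
`prop4` of `B11Prop6Model.SchemeDatum`): on the ball `‖Y‖ < 1/16` of (115), `‖cur(Y)‖₍₋₃₎ ≦ C‖Y‖²` with `C = 1024(d − 1)Λ³‖ρ‖(K + 1/16)` and
`cur` is Fréchet-differentiable there — «The functional derivative of V(A′) is an analytic function on this space, and satisfies the
estimate … (98)», for this group. [cite: Balaban1985Variational, Prop. 4 (97)-(98) pp.292-293] -/
theorem prop4Hyp_curV0prime (ρ : (𝔸 →L[ℂ] ℂ) →L[ℂ] 𝔸) (τ : 𝔸 →L[ℂ] ℂ) (U₀ : Bond d Pd → 𝔸ˣ)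
    (hU : ∀ b, (((U₀ b)⁻¹ : 𝔸ˣ) : 𝔸) = star (U₀ b : 𝔸))
    (hUn : ∀ b, ‖(U₀ b : 𝔸)‖ ≤ 1 ∧ ‖(((U₀ b)⁻¹ : 𝔸ˣ) : 𝔸)‖ ≤ 1)
    (hτ : ∀ a b : 𝔸, τ (a * b) = τ (b * a)) (hτs : ∀ a : 𝔸, τ (star a) = starRingEnd ℂ (τ a))
    (hL : 1 ≤ L) {K Λ : ℝ} (hK : 0 ≤ K) (hΛ0 : 0 ≤ Λ)
    (hΛ : ∀ q ∈ posPlaq (TSite d Pd) (Fin d), ∀ (μ₀ : Fin d) (x₀ : TSite d Pd), q ∈ st Tsh μ₀ x₀ →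
      levWeight L η lev₀ 1 (x₀, μ₀) ≤ Λ * plaqWeight Tsh (levWeight L η lev₀ 1) q)
    (hRe1 : ∀ q ∈ posPlaq (TSite d Pd) (Fin d), ∀ Z : 𝔸,
      ‖(τ : 𝔸 →ₗ[ℂ] ℂ) (Z * (reC (plaqU Tsh (Ucur U₀) q.2.1 q.2.2 q.1) - 1))‖
        ≤ ‖Z‖ * (η ^ 2 * (K / plaqWeight Tsh (levWeight L η lev₀ 1) q ^ 2)))
    (hIm : ∀ q ∈ posPlaq (TSite d Pd) (Fin d), ∀ Z : 𝔸,
      ‖(τ : 𝔸 →ₗ[ℂ] ℂ) (Z * (((η : ℂ) ^ 2)⁻¹ • imC (plaqU Tsh (Ucur U₀) q.2.1 q.2.2 q.1)))‖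
        ≤ ‖Z‖ * (K / plaqWeight Tsh (levWeight L η lev₀ 1) q ^ 2))
    (hW : ∀ q ∈ posPlaq (TSite d Pd) (Fin d), ∀ Z : 𝔸,
      ‖(τ : 𝔸 →ₗ[ℂ] ℂ) (Z * (plaqU Tsh (Ucur U₀) q.2.1 q.2.2 q.1 : 𝔸))‖ ≤ ‖Z‖)
    (hW' : ∀ q ∈ posPlaq (TSite d Pd) (Fin d), ∀ Z : 𝔸,
      ‖(τ : 𝔸 →ₗ[ℂ] ℂ) (Z * (((plaqU Tsh (Ucur U₀) q.2.1 q.2.2 q.1)⁻¹ : 𝔸ˣ) : 𝔸))‖ ≤ ‖Z‖) :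
    B11Prop6Scheme.Prop4Hyp (curV0prime (L := L) (η := η) (lev₀ := lev₀) (lev₁ := lev₁) (Dc := Dc) ρ τ U₀)
      (1024 * ((d - 1 : ℕ) : ℝ) * Λ ^ 3 * ‖ρ‖ * (K + 1 / 16)) (1 / 16) where
  quad Y hY := norm_curV0prime_le_sq (lev₁ := lev₁) (Dc := Dc) ρ τ U₀ hU hUn hτ hτs hL hK hΛ0 hΛ hRe1 hIm hW hW' Y hY
  differentiableOn := (differentiable_curV0prime (lev₁ := lev₁) (Dc := Dc) ρ τ U₀).differentiableOn

/-- **THE `Regime.quad` SLOT AT THE CARRIER FOR THE V′₀-SUMMAND OF (L3) `W`**: `B13Contraction113.QuadAnalytic (curV0prime ρ τ U₀) C (1/16)` — the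
quadratic bound on the ball and analyticity along complex lines (what the Cauchy-formula steps (53)/(119)–(120) consume), from `prop4Hyp_curV0prime`.
[cite: Balaban1985Variational, (98) p.293, (119)-(120) p.295] -/
theorem quadAnalytic_curV0prime (ρ : (𝔸 →L[ℂ] ℂ) →L[ℂ] 𝔸) (τ : 𝔸 →L[ℂ] ℂ) (U₀ : Bond d Pd → 𝔸ˣ)
    (hU : ∀ b, (((U₀ b)⁻¹ : 𝔸ˣ) : 𝔸) = star (U₀ b : 𝔸))
    (hUn : ∀ b, ‖(U₀ b : 𝔸)‖ ≤ 1 ∧ ‖(((U₀ b)⁻¹ : 𝔸ˣ) : 𝔸)‖ ≤ 1)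
    (hτ : ∀ a b : 𝔸, τ (a * b) = τ (b * a)) (hτs : ∀ a : 𝔸, τ (star a) = starRingEnd ℂ (τ a))
    (hL : 1 ≤ L) {K Λ : ℝ} (hK : 0 ≤ K) (hΛ0 : 0 ≤ Λ)
    (hΛ : ∀ q ∈ posPlaq (TSite d Pd) (Fin d), ∀ (μ₀ : Fin d) (x₀ : TSite d Pd), q ∈ st Tsh μ₀ x₀ →
      levWeight L η lev₀ 1 (x₀, μ₀) ≤ Λ * plaqWeight Tsh (levWeight L η lev₀ 1) q)
    (hRe1 : ∀ q ∈ posPlaq (TSite d Pd) (Fin d), ∀ Z : 𝔸,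
      ‖(τ : 𝔸 →ₗ[ℂ] ℂ) (Z * (reC (plaqU Tsh (Ucur U₀) q.2.1 q.2.2 q.1) - 1))‖
        ≤ ‖Z‖ * (η ^ 2 * (K / plaqWeight Tsh (levWeight L η lev₀ 1) q ^ 2)))
    (hIm : ∀ q ∈ posPlaq (TSite d Pd) (Fin d), ∀ Z : 𝔸,
      ‖(τ : 𝔸 →ₗ[ℂ] ℂ) (Z * (((η : ℂ) ^ 2)⁻¹ • imC (plaqU Tsh (Ucur U₀) q.2.1 q.2.2 q.1)))‖
        ≤ ‖Z‖ * (K / plaqWeight Tsh (levWeight L η lev₀ 1) q ^ 2))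
    (hW : ∀ q ∈ posPlaq (TSite d Pd) (Fin d), ∀ Z : 𝔸,
      ‖(τ : 𝔸 →ₗ[ℂ] ℂ) (Z * (plaqU Tsh (Ucur U₀) q.2.1 q.2.2 q.1 : 𝔸))‖ ≤ ‖Z‖)
    (hW' : ∀ q ∈ posPlaq (TSite d Pd) (Fin d), ∀ Z : 𝔸,
      ‖(τ : 𝔸 →ₗ[ℂ] ℂ) (Z * (((plaqU Tsh (Ucur U₀) q.2.1 q.2.2 q.1)⁻¹ : 𝔸ˣ) : 𝔸))‖ ≤ ‖Z‖) :
    B13Contraction113.QuadAnalytic (curV0prime (L := L) (η := η) (lev₀ := lev₀) (lev₁ := lev₁) (Dc := Dc) ρ τ U₀)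
      (1024 * ((d - 1 : ℕ) : ℝ) * Λ ^ 3 * ‖ρ‖ * (K + 1 / 16)) (1 / 16) :=
  (prop4Hyp_curV0prime (lev₁ := lev₁) (Dc := Dc) ρ τ U₀ hU hUn hτ hτs hL hK hΛ0 hΛ hRe1 hIm hW hW').quadAnalytic

end Slots

/-! ## §6 The pairing certificate: (63) with the pairing (27) -/

section Pairing

variable {d : ℕ} {Pd : Fin d → ℕ} {L η : ℝ} {lev₀ : Bond d Pd → ℕ} {κ' : Type*} {lev₁ : κ' → ℕ}
  {Dc : (Bond d Pd → 𝔸) →ₗ[ℂ] (κ' → 𝔸)}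

omit [CompleteSpace 𝔸] in
/-- A bond function is the sum of its one-bond pieces (under the identification `curL`). [cite: Balaban1985Variational, (90) p.291] -/
theorem curL_eq_sum_bondDelta (δ : Bond d Pd → 𝔸) :
    curL δ = ∑ b : Bond d Pd, bondDelta (S := TSite d Pd) b.2 b.1 (δ b) := by
  funext κ y
  simp only [curL_apply, Finset.sum_apply, bondDelta]
  rw [Finset.sum_eq_single (y, κ)]
  · simp
  · rintro ⟨y', κ'⟩ - hne
    rw [if_neg]
    rintro ⟨h1, h2⟩
    exact hne (by rw [h1, h2])
  · intro h; exact absurd (Finset.mem_univ _) h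

/-- **(63) FOR THE V′₀-PART OF `V₀`, THROUGH THE PAIRING (27)** — «⟨(δ/δA′)D(A′), δA′⟩ = (d/dτ)D(A′ + τδA′)|_{τ=0}»: for every direction `δ`,
`⟨cur(Y), δ⟩ = η^d Σ_b τ(cur(Y)(b)·δ(b))` (`B9Eq39Adjoint.bondPair`) EQUALS `(d/dt) Σ_{p} η^d V′₀(Y + tδ, ∂p)|_{t=0}`, provided `ρ` dualises the
trace pairing (`τ(ρ(ℓ)X) = ℓ X`).  So `curV0prime` IS the functional derivative of `A ↦ Σ_p η^d V′₀(A, ∂p)` in print's sense; the proof is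
(63) termwise, the decomposition of `δ` into one-bond pieces, and (90)'s «Σ_{p∈st(b)}» (`dV0primeBond_eq_zero_of_not_mem_st`).
[cite: Balaban1985Variational, (63) p.287, (27) p.282, (90) p.291] -/
theorem bondPair_curV0prime [Fact (0 < L)] [Fact (0 < η)] [Fintype κ'] (ρ : (𝔸 →L[ℂ] ℂ) →L[ℂ] 𝔸) (τ : 𝔸 →L[ℂ] ℂ)
    (hρ : ∀ (ℓ : 𝔸 →L[ℂ] ℂ) (X : 𝔸), τ (ρ ℓ * X) = ℓ X)
    (U₀ : Bond d Pd → 𝔸ˣ) (Y : Space115 L η lev₀ lev₁ Dc) (δ : Bond d Pd → 𝔸) :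
    bondPair η d (τ : 𝔸 →ₗ[ℂ] ℂ) (curL (NegSup.equiv (levWeight L η lev₀ 3) 𝔸 (curV0prime (lev₁ := lev₁) (Dc := Dc) ρ τ U₀ Y))) (curL δ)
      = deriv (fun t : ℂ => ∑ q ∈ posPlaq (TSite d Pd) (Fin d),
          (η : ℂ) ^ d * V0primeP Tsh (Ucur U₀) η (τ : 𝔸 →ₗ[ℂ] ℂ)
            (curL (JetSup.equiv (levWeight L η lev₀ 1) (levWeight L η lev₁ 2) Dc Y) + t • curL δ) q.2.1 q.2.2 q.1) 0 := by
  set A := curL (JetSup.equiv (levWeight L η lev₀ 1) (levWeight L η lev₁ 2) Dc Y) with hA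
  set D := curL (𝔸 := 𝔸) δ with hD
  -- (63) term by term
  have hline : ∀ q : TSite d Pd × Fin d × Fin d, Differentiable ℂ (fun t : ℂ =>
      V0primeP Tsh (Ucur U₀) η (τ : 𝔸 →ₗ[ℂ] ℂ) (A + t • D) q.2.1 q.2.2 q.1) := fun q =>
    ((contDiff_V0primeP Tsh (Ucur U₀) (n := 1) η τ q.2.1 q.2.2 q.1).differentiable (by norm_num)).comp
      (by fun_prop)
  have hq : ∀ q ∈ posPlaq (TSite d Pd) (Fin d), HasDerivAt
      (fun t : ℂ => (η : ℂ) ^ d * V0primeP Tsh (Ucur U₀) η (τ : 𝔸 →ₗ[ℂ] ℂ) (A + t • D) q.2.1 q.2.2 q.1)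
      ((η : ℂ) ^ d * fderiv ℂ (fun B => V0primeP Tsh (Ucur U₀) η (τ : 𝔸 →ₗ[ℂ] ℂ) B q.2.1 q.2.2 q.1) A D) 0 := by
    intro q _
    have h := ((hline q) 0).hasDerivAt.const_mul ((η : ℂ) ^ d)
    rwa [deriv_line_eq_fderiv (((contDiff_V0primeP Tsh (Ucur U₀) (n := 1) η τ q.2.1 q.2.2 q.1).differentiable
      (by norm_num)) A)] at h
  rw [(HasDerivAt.fun_sum hq).deriv]
  -- the direction decomposed into one-bond pieces
  have hexp : ∀ q : TSite d Pd × Fin d × Fin d,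
      fderiv ℂ (fun B => V0primeP Tsh (Ucur U₀) η (τ : 𝔸 →ₗ[ℂ] ℂ) B q.2.1 q.2.2 q.1) A D
        = ∑ b : Bond d Pd, dV0primeBond Tsh (Ucur U₀) η τ A q b.2 b.1 (δ b) := by
    intro q
    rw [hD, curL_eq_sum_bondDelta, map_sum]
    refine Finset.sum_congr rfl fun b _ => ?_
    rw [dV0primeBond, ContinuousLinearMap.comp_apply, δL_apply]
  simp_rw [hexp]
  rw [← Finset.mul_sum, Finset.sum_comm, bondPair, Fintype.sum_prod_type]
  congr 1
  refine Finset.sum_congr rfl fun x _ => Finset.sum_congr rfl fun μ _ => ?_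
  -- only the plaquettes of `st(b)` contribute
  have hzero : ∀ q ∈ posPlaq (TSite d Pd) (Fin d), q ∉ st Tsh μ x →
      dV0primeBond Tsh (Ucur U₀) η τ A q μ x (δ (x, μ)) = 0 := fun q hq hqs => by
    rw [dV0primeBond_eq_zero_of_not_mem_st Tsh (Ucur U₀) η τ A hq hqs, zero_apply]
  rw [← Finset.sum_subset (st_subset_posPlaq Tsh μ x) hzero]
  simp only [curL_apply, curV0prime_apply, Finset.sum_mul, map_sum, ContinuousLinearMap.coe_coe, hρ]
  rfl

end Pairing

/-! ## §7 The dualising map from the cell's Hilbert-fibre convention -/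

section Riesz

variable [StarRing 𝔸] [StarModule ℂ 𝔸] {W : Type*} [NormedAddCommGroup W] [InnerProductSpace ℂ W] [FiniteDimensional ℂ W]
  (φ : W ≃ₗ[ℂ] 𝔸)

omit [CompleteSpace 𝔸] in
/-- **The dualising map of the BILINEAR trace pairing (27)** built from a Hilbert fibre `W` identified with `𝔸 ⊇ 𝔤ᶜ` along `φ` (the cell's
convention `⟪φ⁻¹X, φ⁻¹Y⟫ = τ(X*Y)`, [B7] (18) `‖X‖² = tr X*X`): `ρ(ℓ) = (φ v)*` where `v` is the Riesz vector of `ℓ ∘ φ` — a `ℂ`-LINEAR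
continuous map `(𝔸 →L[ℂ] ℂ) →L[ℂ] 𝔸` (conjugate-linearity of the Riesz map and of `*` cancel). [cite: Balaban1985Averaging, (18) p.21] -/
def rieszτ : (𝔸 →L[ℂ] ℂ) →L[ℂ] 𝔸 :=
  haveI : FiniteDimensional ℂ 𝔸 := LinearEquiv.finiteDimensional φ
  LinearMap.toContinuousLinearMap
    { toFun := fun ℓ => star (φ ((InnerProductSpace.toDual ℂ W).symm
        (ℓ.comp (LinearMap.toContinuousLinearMap φ.toLinearMap))))
      map_add' := fun ℓ₁ ℓ₂ => by
        simp only [ContinuousLinearMap.add_comp, map_add, star_add]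
      map_smul' := fun c ℓ => by
        simp only [ContinuousLinearMap.smul_comp, LinearIsometryEquiv.map_smulₛₗ, map_smul, star_smul,
          RingHom.id_apply, Complex.star_def, Complex.conj_conj] }

omit [CompleteSpace 𝔸] in
/-- Unfolding `rieszτ`. [cite: Balaban1985Averaging, (18) p.21] -/
theorem rieszτ_apply (ℓ : 𝔸 →L[ℂ] ℂ) :
    rieszτ φ ℓ = star (φ ((InnerProductSpace.toDual ℂ W).symm
      (ℓ.comp (haveI : FiniteDimensional ℂ 𝔸 := LinearEquiv.finiteDimensional φ;
        LinearMap.toContinuousLinearMap φ.toLinearMap)))) := rfl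

omit [CompleteSpace 𝔸] in
/-- **`τ(ρ(ℓ)·X) = ℓ(X)`**: under the fibre convention `⟪φ⁻¹X, φ⁻¹Y⟫ = τ(X*Y)` the map `rieszτ φ` dualises the bilinear trace pairing (27) —
the hypothesis `hρ` of `bondPair_curV0prime` DISCHARGED for the cell's letters. [cite: Balaban1985Variational, (27) p.282] -/
theorem trace_rieszτ_mul (τ : 𝔸 →L[ℂ] ℂ) (hφτ : ∀ X Y : 𝔸, ⟪φ.symm X, φ.symm Y⟫_ℂ = τ (star X * Y))
    (ℓ : 𝔸 →L[ℂ] ℂ) (X : 𝔸) : τ (rieszτ φ ℓ * X) = ℓ X := by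
  haveI : FiniteDimensional ℂ 𝔸 := LinearEquiv.finiteDimensional φ
  rw [rieszτ_apply, ← hφτ, LinearEquiv.symm_apply_apply, InnerProductSpace.toDual_symm_apply]
  simp

end Riesz

end Literature.MathematicalPhysics.QuantumFieldTheory.Balaban1983to89.B11Eq98V0primeCurrentSlots

end
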